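import Summits.SmoothPoincare4.SmoothPoincare4.Theorems.ShadowsStandard.Negative.ShadowLevels
import Mathlib.GroupTheory.Index
import Mathlib.Algebra.Group.Subgroup.Pointwise
import HarnessLib

/-!
# Helper `helper_tameLayerTraceCriterion` of line `prym-layer-stable-rank` for crux
`CongruenceShadows.ShadowsStandard` (item stmt-SmoothPoincare4-14593, route route-SmoothPoincare4-CongruenceShadows)

**The coprime-layer (tame) trace criterion.** For a layer `M' ≤ M` of normal subgroups of
`S = SurfaceGroup (3+3m)` with `gcd([S:M], [M:M']) = 1`, a normal subgroup `X ⊇ M'` is DETERMINED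
by its image over `M` (`X ⊔ M`) and its trace on the layer (`X ⊓ M`): `eq_of_coprime_layer`.
Consequence (`helper_tameLayerTraceCriterion`, the registered helper): for a `(3+3m; m+1)` group
trisection `K` of `{1}` normalised on the nose at the characteristic level `M`
(`Kᵢ ⊔ M = Nᵢ ⊔ M`, `N = s4Kernels.stabilizeIter m`) and an automorphism `ψ` of `S`,
`ψ(Nᵢ ⊔ M') = Kᵢ ⊔ M'` holds IFF `ψ` stabilises the level shadow `Nᵢ ⊔ M` AND carries the trace
`(Nᵢ ⊓ M) ⊔ M'` to `(Kᵢ ⊓ M) ⊔ M'`. So the registered stub `stub_tameAbelianDeepLayer` is EXACTLY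
the statement that the level-`M` triple stabiliser `Γ(M) = Stab_{Aut S}(N₀M, N₁M, N₂M)` moves the
submodule triple `Wᵢ(N) = (Nᵢ ∩ M)M'/M'` of the layer `V = M/M'` to `Wᵢ(K)`
(`stub_tameAbelianDeepLayer_of_levelTransitivity`) — the Prym-level transitivity at FIXED genus
that no published big-monodromy theorem supplies (Looijenga 1997: abelian covers; GLLM
arXiv:1307.2593: redundant covers; Putman–Wieland arXiv:1106.2747 Conj. 1.2 open at every fixed genus).
Originally written by wave-1 worker W2; the file declares theorems only.
-/

set_option linter.dupNamespace false

noncomputable section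

namespace Summit.SmoothPoincare4.SmoothPoincare4.Theorems.ShadowsStandard.PrymLayerStableRank

open Literature.Topology.FourManifolds
open Subgroup
open scoped Pointwise

section General

variable {G : Type*} [Group G]

/-- Dedekind's modular law with a normal bottom: `M' ≤ M ⟹ (N ⊓ M) ⊔ M' = (N ⊔ M') ⊓ M`.
[folklore] -/
theorem inf_sup_eq_sup_inf_of_le {N M M' : Subgroup G} [M'.Normal] (h : M' ≤ M) :
    (N ⊓ M) ⊔ M' = (N ⊔ M') ⊓ M := by
  apply SetLike.coe_injective
  show ((N ⊓ M ⊔ M' : Subgroup G) : Set G) = ((N ⊔ M') ⊓ M : Subgroup G)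
  rw [mul_normal, inf_comm N M, inf_mul_assoc M N M' h, coe_inf, mul_normal, Set.inter_comm]

/-- **One inclusion of the coprime-layer uniqueness.** If `X, M ⊴ G`, `X ⊔ M = Y ⊔ M`,
`X ⊓ M = Y ⊓ M` and `gcd([X ⊔ M : M], [M : X ⊓ M]) = 1`, then `Y ≤ X`: the index
`[Y : X ⊓ Y]` divides `[Y : Y ⊓ M] = [X ⊔ M : M]` and `[X ⊔ Y : X] ∣ [X ⊔ M : X] = [M : X ⊓ M]`.
[folklore] -/
theorem le_of_coprime_layer {X Y M : Subgroup G} [X.Normal] [M.Normal]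
    (hsup : X ⊔ M = Y ⊔ M) (hinf : X ⊓ M = Y ⊓ M)
    (hco : Nat.Coprime (M.relIndex (X ⊔ M)) ((X ⊓ M).relIndex M)) : Y ≤ X := by
  have h1 : X.relIndex Y ∣ M.relIndex (X ⊔ M) := by
    have hle : Y ⊓ M ≤ X := hinf ▸ (inf_le_left : X ⊓ M ≤ X)
    calc X.relIndex Y ∣ (Y ⊓ M).relIndex Y := relIndex_dvd_of_le_left Y hle
      _ = M.relIndex Y := inf_relIndex_left Y M
      _ = M.relIndex (Y ⊔ M) := (relIndex_sup_right Y M).symm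
      _ = M.relIndex (X ⊔ M) := by rw [hsup]
  have h2 : X.relIndex Y ∣ (X ⊓ M).relIndex M := by
    have hYX : Y ⊔ X ≤ X ⊔ M := sup_le (le_sup_left.trans hsup.ge) le_sup_left
    have htower := relIndex_mul_relIndex X (Y ⊔ X) (X ⊔ M) le_sup_right hYX
    rw [relIndex_sup_right Y X, relIndex_sup_left M X, ← inf_relIndex_right X M] at htower
    exact Dvd.intro _ htower
  exact relIndex_eq_one.1 (Nat.eq_one_of_dvd_coprimes hco h1 h2)

/-- **Uniqueness across a coprime layer.** Normal subgroups `X, Y` with the same join with `M`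
and the same meet with `M` coincide as soon as `gcd([X ⊔ M : M], [M : X ⊓ M]) = 1` (a normal
Hall-type complement is unique). [folklore] -/
theorem eq_of_coprime_layer {X Y M : Subgroup G} [X.Normal] [Y.Normal] [M.Normal]
    (hsup : X ⊔ M = Y ⊔ M) (hinf : X ⊓ M = Y ⊓ M)
    (hco : Nat.Coprime (M.relIndex (X ⊔ M)) ((X ⊓ M).relIndex M)) : X = Y := by
  refine le_antisymm ?_ (le_of_coprime_layer hsup hinf hco)
  refine le_of_coprime_layer hsup.symm hinf.symm ?_
  rwa [← hsup, ← hinf]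

/-- **The layer shadow from (image, trace).** `M' ≤ M` normal, `gcd([G:M], [M:M']) = 1`,
`N, K ⊴ G`, `ψ ∈ Aut G` with `ψ(M) = M`, `ψ(M') = M'`.  If `ψ(N ⊔ M) = K ⊔ M` and
`ψ((N ⊓ M) ⊔ M') = (K ⊓ M) ⊔ M'`, then `ψ(N ⊔ M') = K ⊔ M'`. [folklore] -/
theorem map_sup_eq_of_layer {N K M M' : Subgroup G} [N.Normal] [K.Normal] [M.Normal] [M'.Normal]
    (hle : M' ≤ M) (hco : Nat.Coprime M.index (M'.relIndex M)) (ψ : G ≃* G)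
    (hM : M.map ψ.toMonoidHom = M) (hM' : M'.map ψ.toMonoidHom = M')
    (htop : (N ⊔ M).map ψ.toMonoidHom = K ⊔ M)
    (hW : ((N ⊓ M) ⊔ M').map ψ.toMonoidHom = (K ⊓ M) ⊔ M') :
    (N ⊔ M').map ψ.toMonoidHom = K ⊔ M' := by
  haveI hNψ : (N.map ψ.toMonoidHom).Normal := Normal.map inferInstance _ ψ.surjective
  have hX : (N ⊔ M').map ψ.toMonoidHom = N.map ψ.toMonoidHom ⊔ M' := by rw [Subgroup.map_sup, hM']
  haveI : ((N ⊔ M').map ψ.toMonoidHom).Normal := by rw [hX]; infer_instance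
  have hsup : (N ⊔ M').map ψ.toMonoidHom ⊔ M = (K ⊔ M') ⊔ M := by
    calc (N ⊔ M').map ψ.toMonoidHom ⊔ M
        = (N ⊔ M').map ψ.toMonoidHom ⊔ M.map ψ.toMonoidHom := by rw [hM]
      _ = (N ⊔ M ⊔ M').map ψ.toMonoidHom := by rw [← Subgroup.map_sup, sup_right_comm]
      _ = (N ⊔ M).map ψ.toMonoidHom := by rw [sup_eq_left.2 (hle.trans le_sup_right)]
      _ = K ⊔ M := htop
      _ = (K ⊔ M') ⊔ M := by rw [sup_right_comm, sup_eq_left.2 (hle.trans le_sup_right)]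
  have hinf : (N ⊔ M').map ψ.toMonoidHom ⊓ M = (K ⊔ M') ⊓ M := by
    calc (N ⊔ M').map ψ.toMonoidHom ⊓ M
        = (N ⊔ M').map ψ.toMonoidHom ⊓ M.map ψ.toMonoidHom := by rw [hM]
      _ = ((N ⊔ M') ⊓ M).map ψ.toMonoidHom := (map_inf_eq _ _ _ ψ.injective).symm
      _ = ((N ⊓ M) ⊔ M').map ψ.toMonoidHom := by rw [inf_sup_eq_sup_inf_of_le hle]
      _ = (K ⊓ M) ⊔ M' := hW
      _ = (K ⊔ M') ⊓ M := inf_sup_eq_sup_inf_of_le hle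
  refine eq_of_coprime_layer hsup hinf ?_
  rw [hsup, hinf, sup_right_comm, sup_eq_left.2 (hle.trans le_sup_right),
    ← inf_sup_eq_sup_inf_of_le hle]
  exact Nat.Coprime.coprime_dvd_right (relIndex_dvd_of_le_left M le_sup_right)
    (Nat.Coprime.coprime_dvd_left (relIndex_dvd_index_of_le le_sup_right) hco)

/-- Converse bookkeeping: from `ψ(N ⊔ M') = K ⊔ M'`, `ψ(M) = M`, `M' ≤ M`, the trace identity
`ψ((N ⊓ M) ⊔ M') = (K ⊓ M) ⊔ M'`. [folklore] -/
theorem map_inf_sup_eq_of_map_sup_eq {N K M M' : Subgroup G} [M'.Normal] (hle : M' ≤ M)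
    (ψ : G ≃* G) (hM : M.map ψ.toMonoidHom = M)
    (h : (N ⊔ M').map ψ.toMonoidHom = K ⊔ M') :
    ((N ⊓ M) ⊔ M').map ψ.toMonoidHom = (K ⊓ M) ⊔ M' := by
  rw [inf_sup_eq_sup_inf_of_le hle, map_inf_eq _ _ _ ψ.injective, h, hM,
    inf_sup_eq_sup_inf_of_le hle]

/-- Converse bookkeeping: from `ψ(N ⊔ M') = K ⊔ M'`, `ψ(M) = M`, `M' ≤ M`, the image identity
`ψ(N ⊔ M) = K ⊔ M`. [folklore] -/
theorem map_sup_eq_of_map_sup_eq_of_le {N K M M' : Subgroup G} (hle : M' ≤ M)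
    (ψ : G ≃* G) (hM : M.map ψ.toMonoidHom = M)
    (h : (N ⊔ M').map ψ.toMonoidHom = K ⊔ M') :
    (N ⊔ M).map ψ.toMonoidHom = K ⊔ M := by
  have e1 : N ⊔ M = (N ⊔ M') ⊔ M := by rw [sup_assoc, sup_eq_right.2 hle]
  have e2 : K ⊔ M = (K ⊔ M') ⊔ M := by rw [sup_assoc, sup_eq_right.2 hle]
  rw [e1, e2, Subgroup.map_sup, h, hM]

end General

/-! ## The stub is exactly a level-`M` transitivity statement on the layer `M/M'` -/

/-- **`stub_tameAbelianDeepLayer` ⟺ Prym-level transitivity (instance by instance).** For a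
coprime layer `M' ≤ M` of characteristic finite-index subgroups of `S = SurfaceGroup (3+3m)`
and a group trisection `K` normalised at `M` (`Kᵢ ⊔ M = Nᵢ ⊔ M`, `N = s4Kernels.stabilizeIter m`),
an automorphism `ψ` of `S` satisfies `ψ(Nᵢ ⊔ M') = Kᵢ ⊔ M'` for all `i` IFF it stabilises the
level-`M` shadow (`ψ(Nᵢ ⊔ M) = Nᵢ ⊔ M`) and carries the layer traces
`(Nᵢ ⊓ M) ⊔ M' ↦ (Kᵢ ⊓ M) ⊔ M'`.  (Only normality of the `Kᵢ`, `M' ≤ M`, characteristic-ness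
and coprimality are used; no chief, abelian or `M ≠ ⊤` hypothesis.) [folklore] -/
theorem map_level_iff_stabilises_and_traces (m : ℕ) (K : TrisectionKernels (3 + 3 * m))
    (hK : IsGroupTrisection (3 + 3 * m) (m + 1) (PUnit : Type) K)
    (M M' : Subgroup (SurfaceGroup (3 + 3 * m))) (hM : M.Characteristic)
    (hM' : M'.Characteristic) (hle : M' ≤ M) (hco : Nat.Coprime M.index (M'.relIndex M))
    (hnorm : ∀ i : Fin 3, K i ⊔ M = s4Kernels.stabilizeIter m i ⊔ M)
    (ψ : SurfaceGroup (3 + 3 * m) ≃* SurfaceGroup (3 + 3 * m)) (i : Fin 3) :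
    (s4Kernels.stabilizeIter m i ⊔ M').map ψ.toMonoidHom = K i ⊔ M' ↔
      (s4Kernels.stabilizeIter m i ⊔ M).map ψ.toMonoidHom = s4Kernels.stabilizeIter m i ⊔ M ∧
        ((s4Kernels.stabilizeIter m i ⊓ M) ⊔ M').map ψ.toMonoidHom = (K i ⊓ M) ⊔ M' := by
  haveI : M.Characteristic := hM
  haveI : M'.Characteristic := hM'
  haveI : (K i).Normal := hK.normal i
  haveI : (s4Kernels.stabilizeIter m i).Normal :=
    (Summit.SmoothPoincare4.SmoothPoincare4.Theorems.ShadowsStandard.Negative.stabilizeIter_isGroupTrisection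
      m).normal i
  have hMψ : M.map ψ.toMonoidHom = M := (characteristic_iff_map_eq.1 hM) ψ
  have hM'ψ : M'.map ψ.toMonoidHom = M' := (characteristic_iff_map_eq.1 hM') ψ
  constructor
  · intro h
    exact ⟨(map_sup_eq_of_map_sup_eq_of_le hle ψ hMψ h).trans (hnorm i),
      map_inf_sup_eq_of_map_sup_eq hle ψ hMψ h⟩
  · rintro ⟨htop, hW⟩
    exact map_sup_eq_of_layer hle hco ψ hMψ hM'ψ (htop.trans (hnorm i).symm) hW

/-- **REGISTERED HELPER `helper_tameLayerTraceCriterion`** (`∀`-form of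
`map_level_iff_stabilises_and_traces`). [folklore] -/
theorem helper_tameLayerTraceCriterion :
    ∀ (m : ℕ) (K : TrisectionKernels (3 + 3 * m)),
      IsGroupTrisection (3 + 3 * m) (m + 1) (PUnit : Type) K →
      ∀ M M' : Subgroup (SurfaceGroup (3 + 3 * m)), M.Characteristic → M'.Characteristic →
      M' ≤ M → Nat.Coprime M.index (M'.relIndex M) →
      (∀ i : Fin 3, K i ⊔ M = s4Kernels.stabilizeIter m i ⊔ M) →
      ∀ (ψ : SurfaceGroup (3 + 3 * m) ≃* SurfaceGroup (3 + 3 * m)) (i : Fin 3),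
      ((s4Kernels.stabilizeIter m i ⊔ M').map ψ.toMonoidHom = K i ⊔ M' ↔
        (s4Kernels.stabilizeIter m i ⊔ M).map ψ.toMonoidHom = s4Kernels.stabilizeIter m i ⊔ M ∧
          ((s4Kernels.stabilizeIter m i ⊓ M) ⊔ M').map ψ.toMonoidHom = (K i ⊓ M) ⊔ M') :=
  fun m K hK M M' hM hM' hle hco hnorm ψ i =>
    map_level_iff_stabilises_and_traces m K hK M M' hM hM' hle hco hnorm ψ i

/-- **The registered stub from level-`M` transitivity on layer traces** (the exact residual:
`∃ ψ ∈ Stab_{Aut S}(N₀M, N₁M, N₂M)` carrying `((Nᵢ ⊓ M) ⊔ M')ᵢ` to `((Kᵢ ⊓ M) ⊔ M')ᵢ`).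
[folklore] -/
theorem stub_tameAbelianDeepLayer_of_levelTransitivity (m : ℕ)
    (K : TrisectionKernels (3 + 3 * m))
    (hK : IsGroupTrisection (3 + 3 * m) (m + 1) (PUnit : Type) K)
    (M M' : Subgroup (SurfaceGroup (3 + 3 * m))) (hM : M.Characteristic)
    (hM' : M'.Characteristic) (hle : M' ≤ M) (hco : Nat.Coprime M.index (M'.relIndex M))
    (hnorm : ∀ i : Fin 3, K i ⊔ M = s4Kernels.stabilizeIter m i ⊔ M)
    (hT : ∃ ψ : SurfaceGroup (3 + 3 * m) ≃* SurfaceGroup (3 + 3 * m), ∀ i : Fin 3,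
      (s4Kernels.stabilizeIter m i ⊔ M).map ψ.toMonoidHom = s4Kernels.stabilizeIter m i ⊔ M ∧
        ((s4Kernels.stabilizeIter m i ⊓ M) ⊔ M').map ψ.toMonoidHom = (K i ⊓ M) ⊔ M') :
    ∃ ψ : SurfaceGroup (3 + 3 * m) ≃* SurfaceGroup (3 + 3 * m), ∀ i : Fin 3,
      (s4Kernels.stabilizeIter m i ⊔ M').map ψ.toMonoidHom = K i ⊔ M' := by
  obtain ⟨ψ, hψ⟩ := hT
  exact ⟨ψ, fun i =>
    (map_level_iff_stabilises_and_traces m K hK M M' hM hM' hle hco hnorm ψ i).2 (hψ i)⟩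

end Summit.SmoothPoincare4.SmoothPoincare4.Theorems.ShadowsStandard.PrymLayerStableRank

end
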